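import Mathlib
import HarnessLib
import Summits.HubbardSuperconductivity.HubbardSuperconductivity.Theorems.KLProgrammeC4aTubeTadpole
import Summits.HubbardSuperconductivity.HubbardSuperconductivity.Theorems.KLProgrammeKLRegimeEngineFrameLevelCount

/-!
# Route `KLProgramme` — crux C4a: the Jacobian weight of the co-moving chart is a SMOOTH SYMBOL READ ALONG THE LEVEL CURVE,
# `levelChartJac μ K (ρ, ϑ) = jacSymbol μ K (Φ(ρ, ϑ))`, `jacSymbol μ K k = ‖k‖² / ⟪k, ∇e_K(k)⟫` — the typed form of the «Jacobian jets» input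

Cell `gate-hubbard-kl`, lane hubbard-kl-c4a-1 (g2); helper for the engine-flow child `KLRegimeEngineV17F2` (stmt-HubbardSuperconductivity-20437),
stub (C) `stub_twoLeg_curvature` (memo HOME/hubbard-kl-c4a-1/C4A-PLAN.md §11 (i)).  The tube tadpole-jet theorem (`…C4aTubeTadpole`,
`…C4aCoMovingJetsL1`) takes the ANGULAR JETS of the Jacobian weight `levelChartJac μ K = u·∂_ρu` as a hypothesis
(`hJjet : ‖∂_ϑⁱ levelChartJac μ K (ρ, ·)‖ ≤ G i`).  This file identifies that weight with a momentum-space symbol composed with the chart: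
`∂_ρ u = ∂_μ u_K = 1/(∇e_K(k)·dir ϑ)` at `k = Φ(ρ, ϑ) = u·dir ϑ` (`hasDerivAt_perturbedFermiRadius_level`), hence
  `u·∂_ρu = ‖k‖² / ⟪k, ∇e_K(k)⟫ = jacSymbol μ K k`,
so that `ϑ ↦ levelChartJac μ K (ρ, ϑ)` IS `jacSymbol μ K ∘ (ϑ ↦ toLp (klFermiPoint (μ+ρ) K ϑ))` — a symbol read along the level-`ρ` curve, whose
angular jets are exactly the shape the tree's composition towers bound (`abs_iteratedDeriv_comp_le_bell`, `…PerturbedFermiCurveTower(OfSizes)`: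
symbol sizes at the curve point × curve sizes `D1…D4`).  What those towers will need of the symbol: the pointwise sizes
`‖Dⁱ jacSymbol μ K (Φ(ρ,ϑ))‖`, `i ≤ 4` — a quotient of `‖k‖²` by `⟪k, ∇e_K k⟫ ≥ u_min·(Dt_min − 2A) > 0` near the curve, involving `‖Dʲ e_K‖`
for `j ≤ 5` (ONE ORDER beyond the frame's `C⁴` sizes: for the flow frame the Jackson pieces' all-order Bernstein bounds supply it).

* §1 `jacSymbol`; `norm_levelPoint` (`‖Φ(ρ,ϑ)‖ = u`); `inner_gradient_frameLevel_levelPoint` (`⟪Φ, ∇e_K Φ⟫ = u·(∂_t e_K along the ray)`);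
* §2 `levelChartJac_eq_jacSymbol`, `levelChartJac_curve_eq_comp` (the function of the angle IS the composition), `jacSymbol_levelPoint_pos`.

Pure calculus on the tree's objects; nothing is asserted about the Hubbard model.  References: BGM 2006 §2.4 Lemma 2.1 (2.40)
[cite: BenfattoGiulianiMastropietro2006]; FST II CPAM 51 (1998) 1133 (H2)(2) (the radial/tangential coordinates).
-/

noncomputable section

namespace Summit.HubbardSuperconductivity.HubbardSuperconductivity.Theorems.C4a

set_option linter.dupNamespace false -- summit = problem name (single-conjunct summit), D-0017

open Real Set MeasureTheory Filter
open scoped Topology RealInnerProductSpace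
open Literature.MathematicalPhysics.QuantumLattice Literature.MathematicalPhysics.QuantumLattice.BandSectorCounting
open Summit.HubbardSuperconductivity.HubbardSuperconductivity.Theorems.DispersionFlow
open Summit.HubbardSuperconductivity.HubbardSuperconductivity.Theorems.KLRegimeSplit
open Summit.HubbardSuperconductivity.HubbardSuperconductivity.Theorems.PerturbedFermiCurve

/-! ## §1 The Jacobian symbol -/

/-- **The Jacobian symbol** of the frame band: `jacSymbol μ K k = ‖k‖² / ⟪k, ∇e_K(k)⟫` (`e_K = frameLevel μ K`; positive near the Fermi curve,
where the radial transversality `⟪k, ∇e_K k⟫ = ‖k‖·∂_t e_K > 0` holds).  Read along the level-`ρ` curve it is the chart's Jacobian weight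
`u·∂_ρu` (`levelChartJac_eq_jacSymbol`). -/
def jacSymbol (μ : ℝ) (K : TrigPolyC4v) (k : Momentum) : ℝ :=
  ‖k‖ ^ 2 / ⟪k, gradient (frameLevel μ K) k⟫

/-- The norm of a scaled direction: `‖toLp (t • dir ϑ)‖ = |t|`. -/
theorem norm_toLp_smul_dir (t ϑ : ℝ) : ‖(WithLp.toLp 2 (t • dir ϑ) : Momentum)‖ = |t| := by
  rw [EuclideanSpace.norm_eq, Fin.sum_univ_two]
  simp only [Pi.smul_apply, smul_eq_mul, Real.norm_eq_abs, dir_zero, dir_one]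
  have h : |t * Real.cos ϑ| ^ 2 + |t * Real.sin ϑ| ^ 2 = t ^ 2 := by
    rw [sq_abs, sq_abs]; nlinarith [Real.cos_sq_add_sin_sq ϑ]
  rw [h, Real.sqrt_sq_eq_abs]

/-- The chart point as a scaled direction: `Φ(ρ, ϑ) = toLp (u • dir ϑ)`, `u = u_K(μ+ρ; ϑ)`. -/
theorem levelPoint_eq_toLp_smul_dir (μ : ℝ) (K : TrigPolyC4v) (ρ ϑ : ℝ) :
    levelPoint μ K ρ ϑ = WithLp.toLp 2 (perturbedFermiRadius (fun k : Fin 2 → ℝ => -K.eval k) (μ + ρ) ϑ • dir ϑ) := rfl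

section Band

variable {a b : ℝ} (B : BandBounds a b) {K : TrigPolyC4v} {A : ℝ}
  (hA : ∀ p : Momentum, ∀ j ≤ 2, ‖iteratedFDeriv ℝ j (frameShift K) p‖ ≤ A) (hADt : 2 * A < B.Dtmin)
  {μ ρ : ℝ} (hlo : a < μ + ρ - A) (hhi : μ + ρ + A < b)
include B hA hADt hlo hhi

omit hADt in
/-- **`‖Φ(ρ, ϑ)‖ = u_K(μ+ρ; ϑ)`** (the radius is positive). -/
theorem norm_levelPoint (ϑ : ℝ) :
    ‖levelPoint μ K ρ ϑ‖ = perturbedFermiRadius (fun k : Fin 2 → ℝ => -K.eval k) (μ + ρ) ϑ := by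
  rw [levelPoint_eq_toLp_smul_dir, norm_toLp_smul_dir, abs_of_pos (levelRadius_pos B hA hlo.le hhi.le ϑ)]

omit B hA hADt hlo hhi in
/-- **The radial derivative of the frame band at the chart point**: along the ray, `d/dt e_K(toLp (t • dir ϑ))` at `t = u` is
`rayDispersionDt ϑ u + Dδ_K(u • dir ϑ)[dir ϑ]`; as a Fréchet derivative applied to `toLp (dir ϑ)`. -/
theorem fderiv_frameLevel_levelPoint_dir (ϑ : ℝ) :
    fderiv ℝ (frameLevel μ K) (levelPoint μ K ρ ϑ) (WithLp.toLp 2 (dir ϑ)) =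
      rayDispersionDt ϑ (perturbedFermiRadius (fun k : Fin 2 → ℝ => -K.eval k) (μ + ρ) ϑ) +
        fderiv ℝ (fun k : Fin 2 → ℝ => -K.eval k)
          (perturbedFermiRadius (fun k : Fin 2 → ℝ => -K.eval k) (μ + ρ) ϑ • dir ϑ) (dir ϑ) := by
  set u : ℝ := perturbedFermiRadius (fun k : Fin 2 → ℝ => -K.eval k) (μ + ρ) ϑ with hu
  -- the ray through the chart point
  have hline : HasDerivAt (fun t : ℝ => (WithLp.toLp 2 (t • dir ϑ) : Momentum)) (WithLp.toLp 2 (dir ϑ)) u := by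
    have h1 : HasDerivAt (fun t : ℝ => t • dir ϑ) (dir ϑ) u := by simpa using (hasDerivAt_id u).smul_const (dir ϑ)
    exact ((PiLp.continuousLinearEquiv 2 ℝ (fun _ : Fin 2 => ℝ)).symm.toContinuousLinearMap.hasFDerivAt.comp_hasDerivAt u h1)
  have hdiff : DifferentiableAt ℝ (frameLevel μ K) (WithLp.toLp 2 (u • dir ϑ)) :=
    ((EngineV8.contDiff_frameLevel μ K (n := 1)).differentiable (by norm_num)) _
  have hcomp : HasDerivAt (fun t : ℝ => frameLevel μ K (WithLp.toLp 2 (t • dir ϑ)))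
      (fderiv ℝ (frameLevel μ K) (WithLp.toLp 2 (u • dir ϑ)) (WithLp.toLp 2 (dir ϑ))) u := by
    have := hdiff.hasFDerivAt.comp_hasDerivAt u hline
    exact this
  -- the same function through the ray dispersion
  have hd : DifferentiableAt ℝ (fun k : Fin 2 → ℝ => -K.eval k) (u • dir ϑ) := by
    rw [← frameShift_toLp_eq_neg_eval]; exact (differentiable_frameShift_toLp K) _
  have hray := hasDerivAt_pertLevel_radius (θ := ϑ) (t := u) hd
  have hfun : (fun t : ℝ => frameLevel μ K (WithLp.toLp 2 (t • dir ϑ))) =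
      fun t : ℝ => (rayDispersion (ϑ, t) + (fun k : Fin 2 → ℝ => -K.eval k) (t • dir ϑ)) - μ := by
    funext t
    rw [frameLevel_toLp, frameShift_toLp]
    simp [rayDispersion]
  have hray' : HasDerivAt (fun t : ℝ => frameLevel μ K (WithLp.toLp 2 (t • dir ϑ)))
      (rayDispersionDt ϑ u + fderiv ℝ (fun k : Fin 2 → ℝ => -K.eval k) (u • dir ϑ) (dir ϑ)) u := by
    rw [hfun]; simpa using hray.sub_const μ
  rw [levelPoint_eq_toLp_smul_dir]
  exact hcomp.unique hray'

omit B hA hADt hlo hhi in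
/-- **`⟪Φ, ∇e_K(Φ)⟫ = u · ∂_t e_K`** at the chart point (`∂_t e_K` = the radial derivative along the ray). -/
theorem inner_gradient_frameLevel_levelPoint (ϑ : ℝ) :
    ⟪levelPoint μ K ρ ϑ, gradient (frameLevel μ K) (levelPoint μ K ρ ϑ)⟫ =
      perturbedFermiRadius (fun k : Fin 2 → ℝ => -K.eval k) (μ + ρ) ϑ *
        (rayDispersionDt ϑ (perturbedFermiRadius (fun k : Fin 2 → ℝ => -K.eval k) (μ + ρ) ϑ) +
          fderiv ℝ (fun k : Fin 2 → ℝ => -K.eval k)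
            (perturbedFermiRadius (fun k : Fin 2 → ℝ => -K.eval k) (μ + ρ) ϑ • dir ϑ) (dir ϑ)) := by
  rw [real_inner_comm, ← InnerProductSpace.toDual_apply_apply (𝕜 := ℝ), toDual_gradient (𝕜 := ℝ),
    ← fderiv_frameLevel_levelPoint_dir (μ := μ) (ρ := ρ) (K := K) ϑ]
  have hk : levelPoint μ K ρ ϑ =
      perturbedFermiRadius (fun k : Fin 2 → ℝ => -K.eval k) (μ + ρ) ϑ • (WithLp.toLp 2 (dir ϑ) : Momentum) := by
    rw [levelPoint_eq_toLp_smul_dir, WithLp.toLp_smul]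
  nth_rw 2 [hk]
  rw [map_smul, smul_eq_mul]

/-! ## §2 The Jacobian weight is the symbol read along the curve -/

/-- **`levelChartJac μ K (ρ, ϑ) = jacSymbol μ K (Φ(ρ, ϑ))`**: `u·∂_ρu = ‖k‖²/⟪k, ∇e_K k⟫` at `k = Φ(ρ,ϑ)`. -/
theorem levelChartJac_eq_jacSymbol (ϑ : ℝ) : levelChartJac μ K (ρ, ϑ) = jacSymbol μ K (levelPoint μ K ρ ϑ) := by
  have hC : ContDiff ℝ ((⊤ : ℕ∞) : WithTop ℕ∞) (fun k : Fin 2 → ℝ => -K.eval k) := by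
    rw [← frameShift_toLp_eq_neg_eval]; exact contDiff_frameShift_toLp K
  have hδ : ∀ k : Fin 2 → ℝ, (∀ i, |k i| ≤ π) → |(fun q : Fin 2 → ℝ => -K.eval q) k| ≤ A := fun k _ => by
    simpa [frameShift_toLp] using abs_frameShift_toLp_le hA k
  have hκ : ∀ k : Fin 2 → ℝ, (∀ i, |k i| ≤ π) → ‖fderiv ℝ (fun q : Fin 2 → ℝ => -K.eval q) k‖ ≤ 2 * A := fun k _ => by
    rw [← frameShift_toLp_eq_neg_eval]; exact norm_fderiv_frameShift_toLp_le hA k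
  have hlev := (hasDerivAt_perturbedFermiRadius_level B hC (by simp) hδ hκ hADt (μ₀ := μ + ρ) hlo hhi ϑ).deriv
  set u : ℝ := perturbedFermiRadius (fun k : Fin 2 → ℝ => -K.eval k) (μ + ρ) ϑ with hu
  set D : ℝ := rayDispersionDt ϑ u + fderiv ℝ (fun k : Fin 2 → ℝ => -K.eval k) (u • dir ϑ) (dir ϑ) with hD
  have hupos : 0 < u := levelRadius_pos B hA hlo.le hhi.le ϑ
  have hJ : levelChartJac μ K (ρ, ϑ) = u * D⁻¹ := by
    rw [levelChartJac_apply]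
    simp only
    rw [hlev]
  have hJpos : 0 < levelChartJac μ K (ρ, ϑ) := by
    rw [levelChartJac_apply]; exact levelChartJac_pos B hA hADt hlo hhi
  have hDpos : 0 < D := by
    have h1 : 0 < u * D⁻¹ := hJ ▸ hJpos
    have h2 : 0 < D⁻¹ := pos_of_mul_pos_right h1 hupos.le
    exact inv_pos.mp h2
  rw [hJ, jacSymbol, norm_levelPoint B hA hlo hhi, inner_gradient_frameLevel_levelPoint (μ := μ) (ρ := ρ) (K := K)]
  rw [← hu, ← hD]
  field_simp

/-- **The Jacobian weight as a function of the angle IS the symbol composed with the level-`ρ` Fermi point map** (the shape of the tree's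
composition towers): `(ϑ ↦ levelChartJac μ K (ρ, ϑ)) = jacSymbol μ K ∘ (ϑ ↦ toLp (klFermiPoint (μ+ρ) K ϑ))`. -/
theorem levelChartJac_curve_eq_comp :
    (fun ϑ : ℝ => levelChartJac μ K (ρ, ϑ)) =
      jacSymbol μ K ∘ fun ϑ : ℝ => (WithLp.toLp 2 (klFermiPoint (μ + ρ) K ϑ) : Momentum) := by
  funext ϑ
  rw [levelChartJac_eq_jacSymbol B hA hADt hlo hhi ϑ]
  rfl

/-- Hence the angular jets of the Jacobian weight are those of the composed symbol. -/
theorem iteratedDeriv_levelChartJac_eq (i : ℕ) (ϑ : ℝ) :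
    iteratedDeriv i (fun s : ℝ => levelChartJac μ K (ρ, s)) ϑ =
      iteratedDeriv i (jacSymbol μ K ∘ fun s : ℝ => (WithLp.toLp 2 (klFermiPoint (μ + ρ) K s) : Momentum)) ϑ := by
  rw [levelChartJac_curve_eq_comp B hA hADt hlo hhi]

/-- The symbol is positive at the chart points. -/
theorem jacSymbol_levelPoint_pos (ϑ : ℝ) : 0 < jacSymbol μ K (levelPoint μ K ρ ϑ) := by
  rw [← levelChartJac_eq_jacSymbol B hA hADt hlo hhi ϑ, levelChartJac_apply]
  exact levelChartJac_pos B hA hADt hlo hhi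

end Band

end Summit.HubbardSuperconductivity.HubbardSuperconductivity.Theorems.C4a
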